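import Literature.AnabelianGeometry.SemiGraphs.CompactInVerticialAtCoveringGraph
import Literature.AnabelianGeometry.SemiGraphs.CoveringGraphGaloisCountable
import Literature.AnabelianGeometry.SemiGraphs.TemperedReconstructionReductionsProofs
import Literature.AnabelianGeometry.SemiGraphs.MorphismsOver
import HarnessLib

/-!
# The edges of a covering semi-graph of anabelioids over an edge `e` and the classes of the edge-like
# subgroups `π̂₁(G_e) → π₁^temp(G)` modulo the open stabiliser ([SemiAnbd] §3, Ex. 3.10 / Thm. 3.7 (iii))

Mochizuki, *Semi-graphs of anabelioids*, Publ. RIMS **42** (2006), §3: Proposition 3.6 (v) p. 39, Theorem 3.7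
(iii) pp. 40–41 (edge-like subgroups), Remark 2.2.1 p. 24 ("the image of each … `Π_b` … is equal to the stabilizer
of a compatible system of … edges"), Example 3.10 p. 44 l. 14 [cite: MochizukiSemiAnbd2006, Ex 3.10 p.44].

PROOF-ONLY file (abc-iut cell, layer L3, seat abc-iut-L3-t2 gen 5, row «Ex310-VERTEX-FIBRES», edge half; no
definition, no instance, no new named fact): the EDGE twin of `CoveringGraphVertexFibres.lean`, same setting (`G`
coherent with the hypotheses of Prop. 3.6, `S` connected tempered, edges of `G_S` over `e` = `Π_e`-orbits `ω` of
`S_e`, charts `c`, `c_S`, `U = Stab_Π(x₀)`, `φ : U ⥲ π₁^temp(G_S)` of route-T brick T1).  Results: the edge dictionary of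
brick T2a AT A PRESCRIBED edge (`exists_isEdgeHom_normalised_at`, `exists_isEdgeHom_coveringGraph_at`); the edge-like
subgroups of `G_S` at `(e, ω)` are EXACTLY the traces `φ(U ∩ L)`, `L` edge-like at `e`
(`exists_traceE_mem_edgeLikeSubgroups`,
`exists_traceE_eq_of_mem_edgeLikeSubgroups`); the base edge is determined (`fst_eq_of_traceE_mem_edgeLikeSubgroups`,
under the per-graph form `EdgeLikeDistinctAt G` of Thm. 3.7 — a theorem at finite `G`); every edge-like `L` at `e` has
its trace edge-like at EXACTLY ONE edge of `G_S` over `e` (`existsUnique_orbit_traceE_mem_edgeLikeSubgroups`, under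
`EdgeLikeDistinctAt G_S` — a theorem at covering graphs of finite `G`); traces of `L, L′` lie at the same edge iff
`L′ = uLu⁻¹`, `u ∈ U` (`tracesE_same_edge_of_mem_stab`, `exists_mem_stab_conj_eq_of_tracesE_same_edge`, the latter
under commensurable rigidity of the edge-like subgroups at `e`, a theorem for graphs / locally finite `G`).  In words:
the edges of `G_S` over `e` are the `U`-conjugacy classes of the edge-like subgroups of `π₁^temp(G)` at `e`.  Nothing
here is about curves; no side is taken on [IUTchIII] Cor. 3.12.
-/

noncomputable section

open CategoryTheory CategoryTheory.Limits Topology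

namespace Literature.AnabelianGeometry.SemiGraphs

open Literature.AlgebraicGeometry.Frobenioids (IsConnectedObj)
open Literature.AlgebraicGeometry.Frobenioids.QuasiTemperoid.BTempConnected (hom_ρ ρ_one_apply
  ρ_mul_apply ρ_inv_apply)
open GaloisObjects (iso_inv_hom_apply iso_hom_inv_apply)

universe u

/-! ### Helpers -/

/-- An open subgroup has finite index relative to a compact subgroup. [folklore] -/
private theorem relIndex_ne_zero_of_isOpen_of_isCompact' {G : Type u} [Group G] [TopologicalSpace G]
    [IsTopologicalGroup G] {A B : Subgroup G} (hA : IsOpen (A : Set G)) (hB : IsCompact (B : Set G)) :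
    A.relIndex B ≠ 0 := by
  haveI : CompactSpace B := isCompact_iff_compactSpace.mp hB
  have hopen : IsOpen ((A.subgroupOf B : Subgroup B) : Set B) := hA.preimage continuous_subtype_val
  haveI : Finite (B ⧸ A.subgroupOf B) := Subgroup.quotient_finite_of_isOpen _ hopen
  exact (Subgroup.finiteIndex_of_finite_quotient (H := A.subgroupOf B)).index_ne_zero

/-- Conjugating a subgroup by one of its elements does not change it. [folklore] -/
private theorem map_conj_eq_self_of_mem' {G : Type u} [Group G] {K : Subgroup G} {g : G} (hg : g ∈ K) :
    K.map (MulAut.conj g).toMonoidHom = K := by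
  ext x
  simp only [Subgroup.mem_map, MulEquiv.coe_toMonoidHom, MulAut.conj_apply]
  constructor
  · rintro ⟨y, hy, rfl⟩
    exact K.mul_mem (K.mul_mem hg hy) (K.inv_mem hg)
  · intro hx
    exact ⟨g⁻¹ * x * g, K.mul_mem (K.mul_mem (K.inv_mem hg) hx) hg, by group⟩

/-- For `u ∈ U` and a homomorphism `φ` on `U`: conjugating the `φ`-image of the trace `U ∩ L` by `φ u` gives the
`φ`-image of the trace of `uLu⁻¹`. [folklore] -/
private theorem map_conj_map_subgroupOf' {G H : Type u} [Group G] [Group H] {U : Subgroup G} (φ : U →* H)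
    (L : Subgroup G) (u : U) :
    ((L.subgroupOf U).map φ).map (MulAut.conj (φ u)).toMonoidHom =
      ((L.map (MulAut.conj (u : G)).toMonoidHom).subgroupOf U).map φ := by
  ext h
  simp only [Subgroup.mem_map, Subgroup.mem_subgroupOf, MulEquiv.coe_toMonoidHom, MulAut.conj_apply]
  constructor
  · rintro ⟨_, ⟨w, hw, rfl⟩, rfl⟩
    refine ⟨u * w * u⁻¹, ⟨(w : G), hw, by simp⟩, by simp [map_mul, map_inv]⟩
  · rintro ⟨w, ⟨l, hl, hlw⟩, rfl⟩
    refine ⟨φ (u⁻¹ * w * u), ⟨u⁻¹ * w * u, ?_, rfl⟩, ?_⟩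
    · have : ((u⁻¹ * w * u : U) : G) = l := by
        simp only [Subgroup.coe_mul, Subgroup.coe_inv, ← hlw]; group
      show ((u⁻¹ * w * u : U) : G) ∈ L
      rw [this]; exact hl
    · simp only [map_mul, map_inv]; group

namespace ProfiniteSemiGraph

namespace CovObj

variable {𝒢 : ProfiniteSemiGraph.{u}} (S : CovObj 𝒢)

/-- Under the hypotheses of Prop. 3.6 every edge has an edge-like subgroup (an edge homomorphism along a branch
abutting to a vertex, which exists since `G` is connected with a vertex). [cite: MochizukiSemiAnbd2006, Thm 3.7(iii) p.41] -/
private theorem exists_isEdgeHom_of_prop36 (h36 : 𝒢.Prop36Hypotheses) (c : TemperedPiChart 𝒢) (e : 𝒢.graph.Edge) :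
    ∃ χ : 𝒢.Ge e →ₜ* c.G, IsEdgeHom c e χ := by
  obtain ⟨v₀⟩ := h36.hasVertex
  obtain ⟨b, hbe, hb⟩ := SemiGraph.exists_abuts_of_isConnected h36.isConnected v₀ e
  obtain ⟨v, hv⟩ := Option.isSome_iff_exists.mp hb
  subst hbe
  exact exists_isEdgeHom h36.isQuasiCoherent h36.isGaloisCountable h36.isOfInjectiveType c b v hv

/-! ### The edge dictionary at a prescribed edge of `G_S` -/

/-- **Normalisation at a prescribed orbit (edges)**: some `Π`-conjugate of an edge homomorphism `χ₀` at `e` has a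
comparison isomorphism sending `s_ω` to `x₀` (`S` connected). [cite: MochizukiSemiAnbd2006, Thm 3.7(iii) p.41] -/
theorem exists_isEdgeHom_normalised_at (c : TemperedPiChart 𝒢) (hS : S.IsTempered)
    (hSc : IsConnectedObj (⟨S, hS⟩ : BTempCat 𝒢)) (ω₀ : BTemp.Orbits (c.equiv.functor.obj ⟨S, hS⟩))
    (e : 𝒢.graph.Edge) (ω : BTemp.Orbits (S.SE e)) (χ₀ : 𝒢.Ge e →ₜ* c.G) (hχ₀ : IsEdgeHom c e χ₀) :
    ∃ (χ : 𝒢.Ge e →ₜ* c.G) (k : ObjectProperty.ι _ ⋙ restrictE 𝒢 e ≅ c.equiv.functor ⋙ BTemp.res χ),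
      IsEdgeHom c e χ ∧
      (k.hom.app ⟨S, hS⟩).hom.hom (Quot.out ω) = (Quot.out ω₀ : (c.equiv.functor.obj ⟨S, hS⟩).obj.V) := by
  haveI := c.isTopologicalGroup
  obtain ⟨j₀⟩ := hχ₀
  let X : BTemp c.G := c.equiv.functor.obj ⟨S, hS⟩
  let x₀ : X.obj.V := Quot.out ω₀
  let s : (S.SE e).obj.V := Quot.out ω
  let G₁ : BTempCat 𝒢 ⥤ BTemp (𝒢.Ge e) := ObjectProperty.ι _ ⋙ restrictE 𝒢 e
  let k₀ : G₁ ≅ c.equiv.functor ⋙ BTemp.res χ₀ :=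
    (Functor.isoWhiskerRight c.equiv.unitIso G₁ : 𝟭 _ ⋙ G₁ ≅ (c.equiv.functor ⋙ c.equiv.inverse) ⋙ G₁) ≪≫
      (Functor.isoWhiskerLeft c.equiv.functor j₀ :
        c.equiv.functor ⋙ (c.equiv.inverse ⋙ G₁) ≅ c.equiv.functor ⋙ BTemp.res χ₀)
  let y₀ : X.obj.V := (k₀.hom.app ⟨S, hS⟩).hom.hom s
  obtain ⟨g, hg⟩ := S.exists_ρ_eq_of_isConnectedObj_chart c hS hSc x₀ y₀
  let κ : c.G →ₜ* c.G :=
    { toMonoidHom := (MulAut.conj g⁻¹).toMonoidHom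
      continuous_toFun := by
        change Continuous fun x => g⁻¹ * x * g⁻¹⁻¹
        fun_prop }
  let χ : 𝒢.Ge e →ₜ* c.G := κ.comp χ₀
  have hχ : ∀ a, g⁻¹ * χ₀ a * g⁻¹⁻¹ = χ a := fun _ => rfl
  let r : BTemp.res χ₀ ≅ BTemp.res χ := BTemp.resIsoOfConj χ₀ χ g⁻¹ hχ
  refine ⟨χ, k₀ ≪≫ Functor.isoWhiskerLeft c.equiv.functor r, ⟨j₀ ≪≫ r⟩, ?_⟩
  change ((r.hom.app X).hom.hom ((k₀.hom.app ⟨S, hS⟩).hom.hom s) : X.obj.V) = x₀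
  rw [BTemp.resIsoOfConj_hom_app_apply]
  change X.obj.ρ g⁻¹ y₀ = x₀
  rw [← hg, ρ_inv_apply]

/-- **An edge homomorphism of `G_S` at EVERY edge `(e, ω)`**: `φ ∘ ψ`, `ψ` the restriction of an edge homomorphism
`χ` of `G` at `e` to `Stab_{Π_e}(s_ω) = χ⁻¹(U)`. [cite: MochizukiSemiAnbd2006, Thm 3.7(iii) p.41] -/
theorem exists_isEdgeHom_coveringGraph_at (h36 : 𝒢.Prop36Hypotheses) (hcoh : 𝒢.IsCoherent)
    (c : TemperedPiChart 𝒢) (hS : S.IsTempered) (hSc : IsConnectedObj (⟨S, hS⟩ : BTempCat 𝒢))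
    (cS : TemperedPiChart S.coveringGraph) (ω₀ : BTemp.Orbits (c.equiv.functor.obj ⟨S, hS⟩))
    (φ : BTemp.stab (c.equiv.functor.obj ⟨S, hS⟩) (Quot.out ω₀) →ₜ* cS.G)
    (hφ : Nonempty (cS.equiv.inverse ⋙ (S.etaleEquiv uniformSplitting_holds h36 hcoh hS).functor ⋙
          (Over.postEquiv (⟨S, hS⟩ : BTempCat 𝒢) c.equiv).functor ⋙
          BTemp.fibreFamily (c.equiv.functor.obj ⟨S, hS⟩) ⋙
          Pi.eval (fun ω => BTemp (BTemp.stab (c.equiv.functor.obj ⟨S, hS⟩) (Quot.out ω))) ω₀ ≅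
        BTemp.res φ))
    (e : 𝒢.graph.Edge) (ω : BTemp.Orbits (S.SE e)) :
    ∃ (χ : 𝒢.Ge e →ₜ* c.G)
      (ψ : BTemp.stab (S.SE e) (Quot.out ω) →ₜ* BTemp.stab (c.equiv.functor.obj ⟨S, hS⟩) (Quot.out ω₀)),
      IsEdgeHom c e χ ∧
      (∀ h, ((ψ h : BTemp.stab (c.equiv.functor.obj ⟨S, hS⟩) (Quot.out ω₀)) : c.G) = χ (h : 𝒢.Ge e)) ∧
      (∀ b : 𝒢.Ge e, b ∈ BTemp.stab (S.SE e) (Quot.out ω) ↔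
        χ b ∈ BTemp.stab (c.equiv.functor.obj ⟨S, hS⟩) (Quot.out ω₀)) ∧
      IsEdgeHom cS (⟨e, ω⟩ : S.coveringGraph.graph.Edge) (φ.comp ψ) := by
  obtain ⟨χ₀, hχ₀⟩ := exists_isEdgeHom_of_prop36 h36 c e
  obtain ⟨χ, k, hχe, hk⟩ := S.exists_isEdgeHom_normalised_at c hS hSc ω₀ e ω χ₀ hχ₀
  obtain ⟨ψ, hψ, hiff, ⟨i⟩⟩ := S.exists_ptFibre_compatE c hS ω₀ e ω χ k hk
  obtain ⟨iφ⟩ := hφ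
  refine ⟨χ, ψ, hχe, hψ, hiff, ⟨?_⟩⟩
  let X : BTemp c.G := c.equiv.functor.obj ⟨S, hS⟩
  let et := S.etaleEquiv uniformSplitting_holds h36 hcoh hS
  let R : BTempCat S.coveringGraph ⥤ BTemp (BTemp.stab (S.SE e) (Quot.out ω)) :=
    ObjectProperty.ι _ ⋙ restrictE S.coveringGraph (⟨e, ω⟩ : S.coveringGraph.graph.Edge)
  let F₁ := Over.post (X := (⟨S, hS⟩ : BTempCat 𝒢)) (ObjectProperty.ι _ ⋙ restrictE 𝒢 e) ⋙
    BTemp.fibreFamily (S.SE e) ⋙ Pi.eval (fun ω' => BTemp (BTemp.stab (S.SE e) (Quot.out ω'))) ω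
  let F₂ := (Over.postEquiv (⟨S, hS⟩ : BTempCat 𝒢) c.equiv).functor ⋙ BTemp.fibreFamily X ⋙
    Pi.eval (fun ω' => BTemp (BTemp.stab X (Quot.out ω'))) ω₀
  let i1 : R ≅ et.functor ⋙ F₁ :=
    (Functor.isoWhiskerRight et.unitIso R : 𝟭 _ ⋙ R ≅ (et.functor ⋙ et.inverse) ⋙ R)
  let i2 : et.functor ⋙ F₁ ≅ et.functor ⋙ F₂ ⋙ BTemp.res ψ := Functor.isoWhiskerLeft et.functor i
  let i3 : cS.equiv.inverse ⋙ R ≅ (cS.equiv.inverse ⋙ et.functor ⋙ F₂) ⋙ BTemp.res ψ :=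
    Functor.isoWhiskerLeft cS.equiv.inverse (i1 ≪≫ i2)
  exact i3 ≪≫ (Functor.isoWhiskerRight iφ (BTemp.res ψ) :
    (cS.equiv.inverse ⋙ et.functor ⋙ F₂) ⋙ BTemp.res ψ ≅ BTemp.res φ ⋙ BTemp.res ψ)

/-! ### The edge dictionary on subgroups -/

/-- **Every edge `(e, ω)` of `G_S` over `e` carries the trace `φ(U ∩ L)` of some edge-like subgroup `L` of `G` at `e` as
an edge-like subgroup.** [cite: MochizukiSemiAnbd2006, Thm 3.7(iii) p.41] -/
theorem exists_traceE_mem_edgeLikeSubgroups (h36 : 𝒢.Prop36Hypotheses) (hcoh : 𝒢.IsCoherent)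
    (c : TemperedPiChart 𝒢) (hS : S.IsTempered) (hSc : IsConnectedObj (⟨S, hS⟩ : BTempCat 𝒢))
    (cS : TemperedPiChart S.coveringGraph) (ω₀ : BTemp.Orbits (c.equiv.functor.obj ⟨S, hS⟩))
    (φ : BTemp.stab (c.equiv.functor.obj ⟨S, hS⟩) (Quot.out ω₀) →ₜ* cS.G)
    (hφ : Nonempty (cS.equiv.inverse ⋙ (S.etaleEquiv uniformSplitting_holds h36 hcoh hS).functor ⋙
          (Over.postEquiv (⟨S, hS⟩ : BTempCat 𝒢) c.equiv).functor ⋙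
          BTemp.fibreFamily (c.equiv.functor.obj ⟨S, hS⟩) ⋙
          Pi.eval (fun ω => BTemp (BTemp.stab (c.equiv.functor.obj ⟨S, hS⟩) (Quot.out ω))) ω₀ ≅
        BTemp.res φ))
    (e : 𝒢.graph.Edge) (ω : BTemp.Orbits (S.SE e)) :
    ∃ L ∈ edgeLikeSubgroups c e,
      (L.subgroupOf (BTemp.stab (c.equiv.functor.obj ⟨S, hS⟩) (Quot.out ω₀))).map φ.toMonoidHom ∈
        edgeLikeSubgroups cS (⟨e, ω⟩ : S.coveringGraph.graph.Edge) := by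
  obtain ⟨χ, ψ, hχe, hψ, hiff, hedge⟩ :=
    S.exists_isEdgeHom_coveringGraph_at h36 hcoh c hS hSc cS ω₀ φ hφ e ω
  refine ⟨χ.toMonoidHom.range, ⟨χ, hχe, rfl⟩, φ.comp ψ, hedge, ?_⟩
  have hψr : ψ.toMonoidHom.range =
      χ.toMonoidHom.range.subgroupOf (BTemp.stab (c.equiv.functor.obj ⟨S, hS⟩) (Quot.out ω₀)) := by
    ext u
    simp only [MonoidHom.mem_range, Subgroup.mem_subgroupOf, ContinuousMonoidHom.coe_toMonoidHom]
    constructor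
    · rintro ⟨h, rfl⟩
      exact ⟨(h : 𝒢.Ge e), (hψ h).symm⟩
    · rintro ⟨b, hb⟩
      have hb' : χ b = (u : c.G) := hb
      have hbmem : b ∈ BTemp.stab (S.SE e) (Quot.out ω) := (hiff b).mpr (by rw [hb']; exact u.2)
      refine ⟨⟨b, hbmem⟩, Subtype.ext ?_⟩
      show ((ψ ⟨b, hbmem⟩ : BTemp.stab (c.equiv.functor.obj ⟨S, hS⟩) (Quot.out ω₀)) : c.G) = u
      rw [hψ]; exact hb'
  change _ = (φ.toMonoidHom.comp ψ.toMonoidHom).range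
  rw [MonoidHom.range_comp, hψr]

/-- **Conversely, EVERY edge-like subgroup of `G_S` at `(e, ω)` is a trace `φ(U ∩ L)` of an edge-like subgroup `L` of
`G` at `e`.** [cite: MochizukiSemiAnbd2006, Thm 3.7(iii) p.41] -/
theorem exists_traceE_eq_of_mem_edgeLikeSubgroups (h36 : 𝒢.Prop36Hypotheses) (hcoh : 𝒢.IsCoherent)
    (c : TemperedPiChart 𝒢) (hS : S.IsTempered) (hSc : IsConnectedObj (⟨S, hS⟩ : BTempCat 𝒢))
    (cS : TemperedPiChart S.coveringGraph) (ω₀ : BTemp.Orbits (c.equiv.functor.obj ⟨S, hS⟩))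
    (φ : BTemp.stab (c.equiv.functor.obj ⟨S, hS⟩) (Quot.out ω₀) →ₜ* cS.G)
    (hφ : Nonempty (cS.equiv.inverse ⋙ (S.etaleEquiv uniformSplitting_holds h36 hcoh hS).functor ⋙
          (Over.postEquiv (⟨S, hS⟩ : BTempCat 𝒢) c.equiv).functor ⋙
          BTemp.fibreFamily (c.equiv.functor.obj ⟨S, hS⟩) ⋙
          Pi.eval (fun ω => BTemp (BTemp.stab (c.equiv.functor.obj ⟨S, hS⟩) (Quot.out ω))) ω₀ ≅
        BTemp.res φ))
    (hφb : Function.Bijective φ) (e : 𝒢.graph.Edge) (ω : BTemp.Orbits (S.SE e)) {H : Subgroup cS.G}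
    (hH : H ∈ edgeLikeSubgroups cS (⟨e, ω⟩ : S.coveringGraph.graph.Edge)) :
    ∃ L ∈ edgeLikeSubgroups c e,
      H = (L.subgroupOf (BTemp.stab (c.equiv.functor.obj ⟨S, hS⟩) (Quot.out ω₀))).map φ.toMonoidHom := by
  obtain ⟨L₀, hL₀, hγ⟩ := S.exists_traceE_mem_edgeLikeSubgroups h36 hcoh c hS hSc cS ω₀ φ hφ e ω
  obtain ⟨m, hm⟩ := exists_conj_of_mem_edgeLikeSubgroups cS hγ hH
  obtain ⟨u, rfl⟩ := hφb.2 m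
  refine ⟨L₀.map (MulAut.conj (u : c.G)).toMonoidHom, conj_mem_edgeLikeSubgroups' c hL₀ u, ?_⟩
  rw [hm]
  exact map_conj_map_subgroupOf' φ.toMonoidHom _ u

/-- **The base edge is determined** (under the per-graph form `EdgeLikeDistinctAt G` of Thm. 3.7, a theorem at finite
`G`): a trace `φ(U ∩ L)` of an edge-like `L` at `e` is edge-like for `G_S` over no edge `e′ ≠ e`.
[cite: MochizukiSemiAnbd2006, Thm 3.7(iii) p.41] -/
theorem fst_eq_of_traceE_mem_edgeLikeSubgroups (h36 : 𝒢.Prop36Hypotheses) (hcoh : 𝒢.IsCoherent)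
    (c : TemperedPiChart 𝒢) (hS : S.IsTempered) (hSc : IsConnectedObj (⟨S, hS⟩ : BTempCat 𝒢))
    (cS : TemperedPiChart S.coveringGraph) (ω₀ : BTemp.Orbits (c.equiv.functor.obj ⟨S, hS⟩))
    (φ : BTemp.stab (c.equiv.functor.obj ⟨S, hS⟩) (Quot.out ω₀) →ₜ* cS.G)
    (hφ : Nonempty (cS.equiv.inverse ⋙ (S.etaleEquiv uniformSplitting_holds h36 hcoh hS).functor ⋙
          (Over.postEquiv (⟨S, hS⟩ : BTempCat 𝒢) c.equiv).functor ⋙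
          BTemp.fibreFamily (c.equiv.functor.obj ⟨S, hS⟩) ⋙
          Pi.eval (fun ω => BTemp (BTemp.stab (c.equiv.functor.obj ⟨S, hS⟩) (Quot.out ω))) ω₀ ≅
        BTemp.res φ))
    (h37 : 𝒢.Thm37Hypotheses) (hED : EdgeLikeDistinctAt 𝒢) (hφb : Function.Bijective φ)
    {e e' : 𝒢.graph.Edge} {ω' : BTemp.Orbits (S.SE e')} {L : Subgroup c.G} (hL : L ∈ edgeLikeSubgroups c e)
    (h : (L.subgroupOf (BTemp.stab (c.equiv.functor.obj ⟨S, hS⟩) (Quot.out ω₀))).map φ.toMonoidHom ∈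
      edgeLikeSubgroups cS (⟨e', ω'⟩ : S.coveringGraph.graph.Edge)) :
    e' = e := by
  haveI := c.isTopologicalGroup
  let X : BTemp c.G := c.equiv.functor.obj ⟨S, hS⟩
  let U : Subgroup c.G := BTemp.stab X (Quot.out ω₀)
  have hUo : IsOpen (U : Set c.G) := X.property.2 _
  obtain ⟨L', hL', hLL'⟩ :=
    S.exists_traceE_eq_of_mem_edgeLikeSubgroups h36 hcoh c hS hSc cS ω₀ φ hφ hφb e' ω' h
  have hinf : L ⊓ U = L' ⊓ U := by
    have h1 : L.subgroupOf U = L'.subgroupOf U := Subgroup.map_injective hφb.1 hLL'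
    rw [← Subgroup.subgroupOf_map_subtype L U, ← Subgroup.subgroupOf_map_subtype L' U, h1]
  by_contra hne
  have h0 : L'.relIndex L = 0 := hED h37 c e e' L L' hL hL' (Ne.symm hne)
  have hle : U ⊓ L ≤ L' := by rw [inf_comm, hinf]; exact inf_le_left
  have h0' : (U ⊓ L).relIndex L = 0 := Subgroup.relIndex_eq_zero_of_le_left hle h0
  rw [Subgroup.inf_relIndex_right] at h0'
  exact relIndex_ne_zero_of_isOpen_of_isCompact' hUo (isCompact_of_mem_edgeLikeSubgroups c hL) h0'

/-- **Every edge-like `L` at `e` has its trace `φ(U ∩ L)` edge-like at EXACTLY ONE edge of `G_S` over `e`** (existence: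
brick T2a; uniqueness: `EdgeLikeDistinctAt G_S`, a theorem at the covering graphs of a finite `G`).
[cite: MochizukiSemiAnbd2006, Thm 3.7(iii) p.41] -/
theorem existsUnique_orbit_traceE_mem_edgeLikeSubgroups (h36 : 𝒢.Prop36Hypotheses) (hcoh : 𝒢.IsCoherent)
    (c : TemperedPiChart 𝒢) (hS : S.IsTempered) (cS : TemperedPiChart S.coveringGraph)
    (ω₀ : BTemp.Orbits (c.equiv.functor.obj ⟨S, hS⟩))
    (φ : BTemp.stab (c.equiv.functor.obj ⟨S, hS⟩) (Quot.out ω₀) →ₜ* cS.G)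
    (hφ : Nonempty (cS.equiv.inverse ⋙ (S.etaleEquiv uniformSplitting_holds h36 hcoh hS).functor ⋙
          (Over.postEquiv (⟨S, hS⟩ : BTempCat 𝒢) c.equiv).functor ⋙
          BTemp.fibreFamily (c.equiv.functor.obj ⟨S, hS⟩) ⋙
          Pi.eval (fun ω => BTemp (BTemp.stab (c.equiv.functor.obj ⟨S, hS⟩) (Quot.out ω))) ω₀ ≅
        BTemp.res φ))
    (h37S : S.coveringGraph.Thm37Hypotheses) (hEDS : EdgeLikeDistinctAt S.coveringGraph)
    (e : 𝒢.graph.Edge) {L : Subgroup c.G} (hL : L ∈ edgeLikeSubgroups c e) :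
    ∃! ω : BTemp.Orbits (S.SE e),
      (L.subgroupOf (BTemp.stab (c.equiv.functor.obj ⟨S, hS⟩) (Quot.out ω₀))).map φ.toMonoidHom ∈
        edgeLikeSubgroups cS (⟨e, ω⟩ : S.coveringGraph.graph.Edge) := by
  obtain ⟨χ₀, hχ₀, rfl⟩ := hL
  obtain ⟨ω, a, χ, ψ, hχ, hψ, hiff, hedge⟩ :=
    S.exists_isEdgeHom_coveringGraph h36 hcoh c hS cS ω₀ φ hφ e χ₀ hχ₀
  have hrange : χ.toMonoidHom.range = χ₀.toMonoidHom.range := by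
    have hg : ∀ b, (χ₀ a)⁻¹ * χ₀ b * (χ₀ a)⁻¹⁻¹ = χ b := fun b => by
      rw [hχ b, map_mul, map_mul, map_inv, inv_inv]
    rw [range_eq_map_conj_of_conj_eq c χ₀ χ (χ₀ a)⁻¹ hg]
    exact map_conj_eq_self_of_mem' (χ₀.toMonoidHom.range.inv_mem ⟨a, rfl⟩)
  have hψr : ψ.toMonoidHom.range =
      χ₀.toMonoidHom.range.subgroupOf (BTemp.stab (c.equiv.functor.obj ⟨S, hS⟩) (Quot.out ω₀)) := by
    rw [← hrange]
    ext u
    simp only [MonoidHom.mem_range, Subgroup.mem_subgroupOf, ContinuousMonoidHom.coe_toMonoidHom]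
    constructor
    · rintro ⟨h, rfl⟩
      exact ⟨(h : 𝒢.Ge e), (hψ h).symm⟩
    · rintro ⟨b, hb⟩
      have hb' : χ b = (u : c.G) := hb
      have hbmem : b ∈ BTemp.stab (S.SE e) (Quot.out ω) := (hiff b).mpr (by rw [hb']; exact u.2)
      refine ⟨⟨b, hbmem⟩, Subtype.ext ?_⟩
      show ((ψ ⟨b, hbmem⟩ : BTemp.stab (c.equiv.functor.obj ⟨S, hS⟩) (Quot.out ω₀)) : c.G) = u
      rw [hψ]; exact hb'
  have hmem : (χ₀.toMonoidHom.range.subgroupOf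
      (BTemp.stab (c.equiv.functor.obj ⟨S, hS⟩) (Quot.out ω₀))).map φ.toMonoidHom ∈
        edgeLikeSubgroups cS (⟨e, ω⟩ : S.coveringGraph.graph.Edge) := by
    refine ⟨φ.comp ψ, hedge, ?_⟩
    change _ = (φ.toMonoidHom.comp ψ.toMonoidHom).range
    rw [MonoidHom.range_comp, hψr]
  refine ⟨ω, hmem, fun ω' hω' => ?_⟩
  by_contra hne
  have hne' : (⟨e, ω'⟩ : S.coveringGraph.graph.Edge) ≠ ⟨e, ω⟩ := fun h =>
    hne (eq_of_heq (Sigma.mk.inj_iff.mp h).2)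
  have h0 := hEDS h37S cS _ _ _ _ hω' hmem hne'
  rw [Subgroup.relIndex_self] at h0
  exact one_ne_zero h0

/-- **`U`-conjugate edge-like subgroups have their traces edge-like at the same edge of `G_S`.**
[cite: MochizukiSemiAnbd2006, Thm 3.7(iii) p.41] -/
theorem tracesE_same_edge_of_mem_stab (c : TemperedPiChart 𝒢) (hS : S.IsTempered)
    (cS : TemperedPiChart S.coveringGraph) (ω₀ : BTemp.Orbits (c.equiv.functor.obj ⟨S, hS⟩))
    (φ : BTemp.stab (c.equiv.functor.obj ⟨S, hS⟩) (Quot.out ω₀) →ₜ* cS.G)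
    {e : 𝒢.graph.Edge} {ω : BTemp.Orbits (S.SE e)} {L : Subgroup c.G}
    (h : (L.subgroupOf (BTemp.stab (c.equiv.functor.obj ⟨S, hS⟩) (Quot.out ω₀))).map φ.toMonoidHom ∈
      edgeLikeSubgroups cS (⟨e, ω⟩ : S.coveringGraph.graph.Edge))
    (u : BTemp.stab (c.equiv.functor.obj ⟨S, hS⟩) (Quot.out ω₀)) :
    ((L.map (MulAut.conj (u : c.G)).toMonoidHom).subgroupOf
        (BTemp.stab (c.equiv.functor.obj ⟨S, hS⟩) (Quot.out ω₀))).map φ.toMonoidHom ∈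
      edgeLikeSubgroups cS (⟨e, ω⟩ : S.coveringGraph.graph.Edge) := by
  rw [← map_conj_map_subgroupOf' φ.toMonoidHom L u]
  exact conj_mem_edgeLikeSubgroups' cS h (φ u)

/-- **Injectivity up to `U`-conjugacy (edges)**: if two edge-like `L, L′` at `e` have their traces edge-like at the SAME
edge of `G_S`, then `L′ = uLu⁻¹` for some `u ∈ U` — provided the edge-like subgroups at `e` are COMMENSURABLY RIGID
(`hCT`: commensurable edge-like subgroups at `e` are equal; a theorem for graphs, `eq_of_commensurable_of_mem_edgeLikeSubgroupsAt`,
and at locally finite `G`). [cite: MochizukiSemiAnbd2006, Thm 3.7(iii) p.41] -/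
theorem exists_mem_stab_conj_eq_of_tracesE_same_edge (c : TemperedPiChart 𝒢) (hS : S.IsTempered)
    (cS : TemperedPiChart S.coveringGraph) (ω₀ : BTemp.Orbits (c.equiv.functor.obj ⟨S, hS⟩))
    (φ : BTemp.stab (c.equiv.functor.obj ⟨S, hS⟩) (Quot.out ω₀) →ₜ* cS.G) (hφb : Function.Bijective φ)
    {e : 𝒢.graph.Edge}
    (hCT : ∀ {L L' : Subgroup c.G}, L ∈ edgeLikeSubgroups c e → L' ∈ edgeLikeSubgroups c e →
      Subgroup.Commensurable L L' → L = L')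
    {ω : BTemp.Orbits (S.SE e)} {L L' : Subgroup c.G}
    (hL : L ∈ edgeLikeSubgroups c e) (hL' : L' ∈ edgeLikeSubgroups c e)
    (h : (L.subgroupOf (BTemp.stab (c.equiv.functor.obj ⟨S, hS⟩) (Quot.out ω₀))).map φ.toMonoidHom ∈
      edgeLikeSubgroups cS (⟨e, ω⟩ : S.coveringGraph.graph.Edge))
    (h' : (L'.subgroupOf (BTemp.stab (c.equiv.functor.obj ⟨S, hS⟩) (Quot.out ω₀))).map φ.toMonoidHom ∈
      edgeLikeSubgroups cS (⟨e, ω⟩ : S.coveringGraph.graph.Edge)) :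
    ∃ u : BTemp.stab (c.equiv.functor.obj ⟨S, hS⟩) (Quot.out ω₀),
      L' = L.map (MulAut.conj (u : c.G)).toMonoidHom := by
  haveI := c.isTopologicalGroup
  let X : BTemp c.G := c.equiv.functor.obj ⟨S, hS⟩
  let U : Subgroup c.G := BTemp.stab X (Quot.out ω₀)
  have hUo : IsOpen (U : Set c.G) := X.property.2 _
  obtain ⟨m, hm⟩ := exists_conj_of_mem_edgeLikeSubgroups cS h h'
  obtain ⟨u, rfl⟩ := hφb.2 m
  refine ⟨u, ?_⟩
  rw [show φ u = φ.toMonoidHom u from rfl, map_conj_map_subgroupOf' φ.toMonoidHom L u] at hm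
  set L'' : Subgroup c.G := L.map (MulAut.conj (u : c.G)).toMonoidHom with hL''def
  have hL''e : L'' ∈ edgeLikeSubgroups c e := conj_mem_edgeLikeSubgroups' c hL u
  have hinf : L' ⊓ U = L'' ⊓ U := by
    have h1 : L'.subgroupOf U = L''.subgroupOf U := Subgroup.map_injective hφb.1 hm
    rw [← Subgroup.subgroupOf_map_subtype L' U, ← Subgroup.subgroupOf_map_subtype L'' U, h1]
  have hfin' : U.relIndex L' ≠ 0 :=
    relIndex_ne_zero_of_isOpen_of_isCompact' hUo (isCompact_of_mem_edgeLikeSubgroups c hL')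
  have hfin'' : U.relIndex L'' ≠ 0 :=
    relIndex_ne_zero_of_isOpen_of_isCompact' hUo (isCompact_of_mem_edgeLikeSubgroups c hL''e)
  have hc : Subgroup.Commensurable L' L'' := by
    constructor
    · intro h0
      have hle : U ⊓ L'' ≤ L' := by rw [inf_comm, ← hinf]; exact inf_le_left
      have := Subgroup.relIndex_eq_zero_of_le_left hle h0
      rw [Subgroup.inf_relIndex_right] at this
      exact hfin'' this
    · intro h0
      have hle : U ⊓ L' ≤ L'' := by rw [inf_comm, hinf]; exact inf_le_left
      have := Subgroup.relIndex_eq_zero_of_le_left hle h0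
      rw [Subgroup.inf_relIndex_right] at this
      exact hfin' this
  exact hCT hL' hL''e hc

end CovObj

end ProfiniteSemiGraph

end Literature.AnabelianGeometry.SemiGraphs

end
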